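import Summits.Ventures.PercRepro.ProfilePointedCircuitClassesStarSharpPencilD

/-!
# PercRepro — THE PENCIL THROUGH `ℓ ∈ X`, PART E: THE FREE CROSS BI-BASES OF A D1 DEMAND
(p5, gen 56; `proofs/P5-GM1.md` §83)

For a D1 demand `π + e + b` (`c1`, `ℓ ∉ π`; data `pencilX_D1_data`) with `X ∖ π = {ℓ, u, v}`: a point `y ∈ {u, v}`
is off the plane `cl(π + e)` (`pencilX_D1_rk_insert_eq_four`: otherwise `cl{e, ℓ, y}` would be both planes through
`eℓ` and `X` would have rank 3), so a CROSS pair `{x, y}` (`x ∈ π`) with `ρ{e, f, x, y} = 4` gives a free bi-basis of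
the X-class (`pencilX_cross_free_mem`: its complement `{ℓ, x̄, ȳ}` is OFF, its pair `{x, y} + e` is not ON), and for
each `y ∈ {u, v}` one of the two cross pairs at `y` has rank 4 with `e, f` (`pencilX_cross_exists`: two planes
through the line `ey` both containing `f` would put `f` on the line `ey`, against `y ∉ P_f`).  Hence the X-class sees
at least two free bi-bases (`pencilX_two_le_card_free_X`).
-/

open scoped Matroid

namespace PercRepro.Cogirth

open Finset ThmH Skew Shadow Profile

open Classical

variable {α : Type} [DecidableEq α] {N : Matroid α} [N.Finite]

section StarSharpPencilE

variable {b b' : α}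

/-- **A CROSS PAIR OF RANK 4 WITH `e, f` IS A FREE BI-BASIS OF THE X-CLASS**: for a D1 demand with data as in
`pencilX_D1_data`, `x ∈ π`, `y ∈ X ∖ π − ℓ` and `ρ{e, f, x, y} = 4`, the set `{x, y} + e + f` is a bi-basis of the
third kind outside the image of `d0_injR2''`, avoiding `ℓ`, with both pair points off `P_f`. -/
theorem pencilX_cross_free_mem (hn : (gr N).card = 9) (h : SeriesPair N b b') {e f : α} (he : e ∈ gr N)
    (hf : f ∈ gr N) (hef : e ≠ f) (heb : e ≠ b) (heb' : e ≠ b') (hfb : f ≠ b) (hfb' : f ≠ b')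
    (he1 : ∀ y ∈ ((((gr N).erase b).erase b').erase f).erase e, rk N {e, y} = 2)
    (hX : rk N (((((gr N).erase b).erase b').erase f).erase e) = 4) (heb3 : rk N {e, b, b'} = 3)
    (hbg : ∀ y ∈ ((((gr N).erase b).erase b').erase f).erase e, rk N {y, b, b'} = 3)
    {l : α} (hlX : l ∈ ((((gr N).erase b).erase b').erase f).erase e) (hlon : rk N (insert b (insert b' {e, l})) = 3)
    {π : Finset α} (hπX : π ⊆ ((((gr N).erase b).erase b').erase f).erase e) (hπ2 : π.card = 2)
    (hπe : rk N (insert e π) = 3)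
    (hB1 : rk N (insert e (((((gr N).erase b).erase b').erase f).erase e \ π)) = 3)
    (hlτ : l ∈ ((((gr N).erase b).erase b').erase f).erase e \ π)
    (hlcl : rk N (insert l (insert e π)) = 3)
    (hd : ∀ x ∈ π, rk N (insert f (insert e {l, x})) = 4)
    (he' : ∀ y ∈ (((((gr N).erase b).erase b').erase f).erase e \ π).erase l,
      rk N (insert f (insert e {l, y})) = 4)
    {x : α} (hx : x ∈ π) {y : α} (hy : y ∈ (((((gr N).erase b).erase b').erase f).erase e \ π).erase l)
    (h4 : rk N (insert f (insert e {x, y})) = 4) :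
    insert f (insert e {x, y}) ∈ (biIndepSets N 4).filter (fun B =>
      (((f ∈ B ∧ b' ∉ B) ∧ (e ∈ B ∧ b ∉ B)) ∧
        ¬ (insert b (B.erase f) ∈ biIndepSets N 4 ∧ rk N (insert b (insert b' (B.erase f))) = 4)) ∧
      (l ∉ B ∧ ∀ z ∈ (B.erase e).erase f, rk N (insert f (insert e {l, z})) = 4)) := by
  set X := ((((gr N).erase b).erase b').erase f).erase e with hXdef
  have hXE : X ⊆ ((gr N).erase b).erase b' := (erase_subset _ _).trans (erase_subset _ _)
  have hXg : X ⊆ gr N := hXE.trans ((erase_subset _ _).trans (erase_subset _ _))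
  have heE : e ∈ ((gr N).erase b).erase b' := mem_erase.2 ⟨heb', mem_erase.2 ⟨heb, he⟩⟩
  have hyτ : y ∈ X \ π := mem_of_mem_erase hy
  have hyl : y ≠ l := (mem_erase.1 hy).1
  have hyX : y ∈ X := (mem_sdiff.1 hyτ).1
  have hyπ : y ∉ π := (mem_sdiff.1 hyτ).2
  have hxX : x ∈ X := hπX hx
  have hxy : x ≠ y := fun h' => hyπ (h' ▸ hx)
  have hxe : x ≠ e := (mem_erase.1 hxX).1
  have hxf : x ≠ f := (mem_erase.1 (mem_erase.1 hxX).2).1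
  have hye : y ≠ e := (mem_erase.1 hyX).1
  have hyf : y ≠ f := (mem_erase.1 (mem_erase.1 hyX).2).1
  have hle : l ≠ e := (mem_erase.1 hlX).1
  have hlf : l ≠ f := (mem_erase.1 (mem_erase.1 hlX).2).1
  have hlπ : l ∉ π := (mem_sdiff.1 hlτ).2
  have hlx : l ≠ x := fun h' => hlπ (h' ▸ hx)
  -- ranks of `{e, ℓ, x}` and `{e, ℓ, y}`
  have hxL : rk N (insert e {l, x}) = 3 := by
    have h1 := rk_insert_le_add_one (N := N) hf (X := insert e ({l, x} : Finset α))
      (insert_subset he (insert_subset (hXg hlX) (singleton_subset_iff.2 (hXg hxX))))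
    have h2 := rk_le_card' (M := N) (insert e ({l, x} : Finset α))
    have h3 := card_insert_le e ({l, x} : Finset α)
    have h5 := card_le_two (a := l) (b := x)
    rw [hd x hx] at h1
    omega
  have hyL : rk N (insert e {l, y}) = 3 := by
    have h1 := rk_insert_le_add_one (N := N) hf (X := insert e ({l, y} : Finset α))
      (insert_subset he (insert_subset (hXg hlX) (singleton_subset_iff.2 (hXg hyX))))
    have h2 := rk_le_card' (M := N) (insert e ({l, y} : Finset α))
    have h3 := card_insert_le e ({l, y} : Finset α)
    have h5 := card_le_two (a := l) (b := y)
    rw [he' y hy] at h1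
    omega
  have hy4 := pencilX_D1_rk_insert_eq_four hX hπ2 hπe hB1 hlτ hlcl hy hyL
  -- the other points `x′ ∈ π`, `y′ ∈ X ∖ π − ℓ`
  obtain ⟨x', hx'x, hx'π, hπeq⟩ := pair_eq_insert_of_mem hπ2 hx
  have hτc : (X \ π).card = 3 := card_X_sdiff_pair hn h he hf hef heb heb' hfb hfb' hπX hπ2
  have hτl2 : ((X \ π).erase l).card = 2 := by rw [card_erase_of_mem hlτ, hτc]
  obtain ⟨y', hy'y, hy', hτeq⟩ := pair_eq_insert_of_mem hτl2 hy
  have hy'τ : y' ∈ X \ π := mem_of_mem_erase hy'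
  have hx'L : rk N (insert e {l, x'}) = 3 := by
    have h1 := rk_insert_le_add_one (N := N) hf (X := insert e ({l, x'} : Finset α))
      (insert_subset he (insert_subset (hXg hlX) (singleton_subset_iff.2 (hXg (hπX hx'π)))))
    have h2 := rk_le_card' (M := N) (insert e ({l, x'} : Finset α))
    have h3 := card_insert_le e ({l, x'} : Finset α)
    have h5 := card_le_two (a := l) (b := x')
    rw [hd x' hx'π] at h1
    omega
  have hy'L : rk N (insert e {l, y'}) = 3 := by
    have h1 := rk_insert_le_add_one (N := N) hf (X := insert e ({l, y'} : Finset α))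
      (insert_subset he (insert_subset (hXg hlX) (singleton_subset_iff.2 (hXg (mem_sdiff.1 hy'τ).1))))
    have h2 := rk_le_card' (M := N) (insert e ({l, y'} : Finset α))
    have h3 := card_insert_le e ({l, y'} : Finset α)
    have h5 := card_le_two (a := l) (b := y')
    rw [he' y' hy'] at h1
    omega
  have hy'4 := pencilX_D1_rk_insert_eq_four hX hπ2 hπe hB1 hlτ hlcl hy' hy'L
  -- the complement `S = X ∖ {x, y} ∋ ℓ, x′, y′`
  have hlS : l ∈ X \ {x, y} := mem_sdiff.2 ⟨hlX, by
    simp only [mem_insert, mem_singleton, not_or]; exact ⟨hlx, hyl.symm⟩⟩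
  have hx'S : x' ∈ X \ {x, y} := mem_sdiff.2 ⟨hπX hx'π, by
    simp only [mem_insert, mem_singleton, not_or]; exact ⟨hx'x, fun h' => hyπ (h' ▸ hx'π)⟩⟩
  have hy'S : y' ∈ X \ {x, y} := mem_sdiff.2 ⟨(mem_sdiff.1 hy'τ).1, by
    simp only [mem_insert, mem_singleton, not_or]
    exact ⟨fun h' => (mem_sdiff.1 hy'τ).2 (h' ▸ hx), hy'y⟩⟩
  have hSE : X \ {x, y} ⊆ ((gr N).erase b).erase b' := sdiff_subset.trans hXE
  -- `x ∈ cl{e, ℓ, x′}` and so `ρ((X ∖ {x, y}) + e) = 4`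
  have hxcl : rk N (insert x (insert e {l, x'})) = rk N (insert e {l, x'}) := by
    have h1 : rk N (insert x (insert e {l, x'})) ≤ rk N (insert l (insert e π)) := by
      apply rk_mono'
      rw [hπeq]
      intro z hz; simp only [mem_insert, mem_singleton] at hz ⊢; tauto
    have h2 : rk N (insert e {l, x'}) ≤ rk N (insert x (insert e {l, x'})) := rk_mono' (subset_insert _ _)
    rw [hlcl] at h1
    rw [hx'L] at h2 ⊢
    omega
  have hxcl' := rk_insert_eq_of_rk_insert_eq_subset' (N := N) (S := insert e {l, x'}) (S' := insert e (X \ {x, y}))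
    (insert_subset (mem_insert_self _ _) (insert_subset (mem_insert_of_mem hlS)
      (singleton_subset_iff.2 (mem_insert_of_mem hx'S)))) hxcl
  have heS4 : rk N (insert e (X \ {x, y})) = 4 := by
    have h1 : rk N (insert y' (insert e π)) ≤ rk N (insert x (insert e (X \ {x, y}))) := by
      apply rk_mono'
      rw [hπeq]
      exact insert_y'_e_pair_subset_insert_x_e hx'S hy'S
    have h2 := rk_le_card' (M := N) (insert e (X \ {x, y}))
    have h3 := card_insert_le e (X \ {x, y})
    have h5 : (X \ {x, y}).card = 3 := by
      rw [card_sdiff_of_subset (insert_subset hxX (singleton_subset_iff.2 hyX)),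
        card_X_eq_five hn h he hf hef heb heb' hfb hfb', card_pair hxy]
    rw [hy'4, hxcl'] at h1
    omega
  have hS3 : rk N (X \ {x, y}) = 3 := by
    have h1 := rk_insert_le_add_one (N := N) he (X := X \ {x, y}) (hSE.trans ((erase_subset _ _).trans (erase_subset _ _)))
    have h2 := rk_le_card' (M := N) (X \ {x, y})
    have h5 : (X \ {x, y}).card = 3 := by
      rw [card_sdiff_of_subset (insert_subset hxX (singleton_subset_iff.2 hyX)),
        card_X_eq_five hn h he hf hef heb heb' hfb hfb', card_pair hxy]
    rw [heS4] at h1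
    omega
  -- the complement is OFF
  have hoff : rk N (insert b (insert b' (X \ {x, y}))) = 5 := by
    apply rk_insert_bb'_eq_five_of_not_on h hSE hS3
    intro h4'
    have hon : rk N (insert b (insert b' (X \ {x, y}))) = rk N (X \ {x, y}) + 1 := by rw [h4', hS3]
    rw [on_iff_of_line_le h he heb heb' he1 hbg hlX hlon hSE hlS, hS3, heS4] at hon
    omega
  -- the pair `{x, y} + e` is not ON
  have hxy3 : rk N (insert e {x, y}) = 3 := by
    have h1 := rk_insert_le_add_one (N := N) hf (X := insert e ({x, y} : Finset α))
      (insert_subset he (insert_subset (hXg hxX) (singleton_subset_iff.2 (hXg hyX))))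
    have h2 := rk_le_card' (M := N) (insert e ({x, y} : Finset α))
    have h3 := card_insert_le e ({x, y} : Finset α)
    have h5 := card_le_two (a := x) (b := y)
    rw [h4] at h1
    omega
  have hnon : ¬ rk N (insert b (insert b' (insert e {x, y}))) = 4 := by
    intro hon4
    have hon : rk N (insert b (insert b' (insert e {x, y}))) = rk N (insert e {x, y}) + 1 := by rw [hon4, hxy3]
    have hxyE : insert e ({x, y} : Finset α) ⊆ ((gr N).erase b).erase b' :=
      insert_subset heE (insert_subset (hXE hxX) (singleton_subset_iff.2 (hXE hyX)))
    rw [on_iff_of_line_el h he he1 heb3 hlX hlon hxyE (mem_insert_self _ _), hxy3] at hon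
    -- `y ∈ cl{e, ℓ, x}`
    have h1 : rk N (insert y (insert e {l, x})) ≤ rk N (insert l (insert e {x, y})) :=
      rk_mono' (insert_y_e_lx_subset e l x y)
    have h2 : rk N (insert e {l, x}) ≤ rk N (insert y (insert e {l, x})) := rk_mono' (subset_insert _ _)
    rw [hon] at h1
    rw [hxL] at h2
    have hycl : rk N (insert y (insert e {l, x})) = rk N (insert e {l, x}) := by rw [hxL]; omega
    have h3 := rk_insert_eq_of_rk_insert_eq_subset' (N := N) (S := insert e {l, x}) (S' := insert l (insert e π))
      (by rw [hπeq]; exact insert_e_lx_subset_insert_l_e_xy e l x x') hycl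
    have h5 : rk N (insert y (insert e π)) ≤ rk N (insert y (insert l (insert e π))) :=
      rk_mono' (insert_subset_insert _ (subset_insert _ _))
    rw [h3, hlcl, hy4] at h5
    omega
  have hq := free_bibasis_mem hn h he hf hef heb heb' hfb hfb' hxX hyX hxy h4 hoff hnon
  simp only [mem_filter] at hq ⊢
  refine ⟨hq.1, hq.2, ?_, ?_⟩
  · simp only [mem_insert, mem_singleton, not_or]
    exact ⟨hlf, hle, hlx, hyl.symm⟩
  · rw [erase_erase_insert_f_insert_e hxe hxf hye hyf]
    intro z hz
    simp only [mem_insert, mem_singleton] at hz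
    rcases hz with rfl | rfl
    · exact hd z hx
    · exact he' z hy

/-- **ONE OF THE TWO CROSS PAIRS AT `y` HAS RANK 4 WITH `e, f`**: for a D1 demand `π = {s, t}` and `y ∈ X ∖ π − ℓ`,
`ρ{e, f, s, y} = 4` or `ρ{e, f, t, y} = 4` (two planes through the line `ey` both containing `f` would force
`ρ{e, f, y} ≤ 2`, against `y ∉ P_f`). -/
theorem pencilX_cross_exists {e f : α} (he : e ∈ gr N) (hf : f ∈ gr N)
    (hX : rk N (((((gr N).erase b).erase b').erase f).erase e) = 4)
    {π : Finset α} (hπ2 : π.card = 2)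
    (hπe : rk N (insert e π) = 3)
    (hB1 : rk N (insert e (((((gr N).erase b).erase b').erase f).erase e \ π)) = 3)
    {l : α} (hlX : l ∈ ((((gr N).erase b).erase b').erase f).erase e)
    (hlτ : l ∈ ((((gr N).erase b).erase b').erase f).erase e \ π)
    (hlcl : rk N (insert l (insert e π)) = 3)
    (he' : ∀ y ∈ (((((gr N).erase b).erase b').erase f).erase e \ π).erase l,
      rk N (insert f (insert e {l, y})) = 4)
    {y : α} (hy : y ∈ (((((gr N).erase b).erase b').erase f).erase e \ π).erase l) :
    ∃ x ∈ π, rk N (insert f (insert e {x, y})) = 4 := by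
  set X := ((((gr N).erase b).erase b').erase f).erase e with hXdef
  have hXg : X ⊆ gr N :=
    (erase_subset _ _).trans ((erase_subset _ _).trans ((erase_subset _ _).trans (erase_subset _ _)))
  have hyX : y ∈ X := (mem_sdiff.1 (mem_of_mem_erase hy)).1
  have hyL : rk N (insert e {l, y}) = 3 := by
    have h1 := rk_insert_le_add_one (N := N) hf (X := insert e ({l, y} : Finset α))
      (insert_subset he (insert_subset (hXg hlX) (singleton_subset_iff.2 (hXg hyX))))
    have h2 := rk_le_card' (M := N) (insert e ({l, y} : Finset α))
    have h3 := card_insert_le e ({l, y} : Finset α)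
    have h5 := card_le_two (a := l) (b := y)
    rw [he' y hy] at h1
    omega
  have hy4 := pencilX_D1_rk_insert_eq_four hX hπ2 hπe hB1 hlτ hlcl hy hyL
  obtain ⟨s, t, hst, hπeq⟩ := card_eq_two.1 hπ2
  have hsπ : s ∈ π := by rw [hπeq]; exact mem_insert_self _ _
  have htπ : t ∈ π := by rw [hπeq]; exact mem_insert_of_mem (mem_singleton_self _)
  by_contra hno
  have hs3 : rk N (insert f (insert e {s, y})) ≤ 3 := by
    have h1 : ¬ rk N (insert f (insert e {s, y})) = 4 := fun h' => hno ⟨s, hsπ, h'⟩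
    have h2 := rk_le_card' (M := N) (insert f (insert e ({s, y} : Finset α)))
    have h3 := card_insert_le f (insert e ({s, y} : Finset α))
    have h4 := card_insert_le e ({s, y} : Finset α)
    have h5 := card_le_two (a := s) (b := y)
    omega
  have ht3 : rk N (insert f (insert e {t, y})) ≤ 3 := by
    have h1 : ¬ rk N (insert f (insert e {t, y})) = 4 := fun h' => hno ⟨t, htπ, h'⟩
    have h2 := rk_le_card' (M := N) (insert f (insert e ({t, y} : Finset α)))
    have h3 := card_insert_le f (insert e ({t, y} : Finset α))
    have h4 := card_insert_le e ({t, y} : Finset α)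
    have h5 := card_le_two (a := t) (b := y)
    omega
  have hsm := rk_union_add_rk_le_of_subset_inter' (N := N) (S := insert f (insert e {s, y}))
    (T := insert f (insert e {t, y})) (I := {e, f, y}) (efy_subset_inter e f s t y)
  have hU : rk N (insert y (insert e {s, t})) ≤
      rk N (insert f (insert e {s, y}) ∪ insert f (insert e {t, y})) :=
    rk_mono' (insert_y_e_pair_subset_union e f s t y)
  rw [hπeq] at hy4
  rw [hy4] at hU
  have h8 := rk_insert_le_add_one (N := N) (hXg hlX) (X := ({e, f, y} : Finset α))
    (insert_subset he (insert_subset hf (singleton_subset_iff.2 (hXg hyX))))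
  rw [insert_l_eft_eq, he' y hy] at h8
  omega

/-- **THE X-CLASS SEES AT LEAST TWO FREE BI-BASES**: for a bad demand with `c1` avoiding `ℓ`, two distinct free cross
bi-bases (one at each point of `X ∖ π − ℓ`). -/
theorem pencilX_two_le_card_free_X (hn : (gr N).card = 9) (hR : rk N (gr N) = 5) (h : SeriesPair N b b') {e f : α}
    (he : e ∈ gr N) (hf : f ∈ gr N) (hef : e ≠ f) (heb : e ≠ b) (heb' : e ≠ b') (hfb : f ≠ b) (hfb' : f ≠ b')
    (he1 : ∀ y ∈ ((((gr N).erase b).erase b').erase f).erase e, rk N {e, y} = 2)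
    (hfc : ∀ y ∈ ((((gr N).erase b).erase b').erase f).erase e, rk N (((((gr N).erase b).erase b').erase f).erase y) = 4)
    (hX : rk N (((((gr N).erase b).erase b').erase f).erase e) = 4) (heb3 : rk N {e, b, b'} = 3)
    (hbg : ∀ y ∈ ((((gr N).erase b).erase b').erase f).erase e, rk N {y, b, b'} = 3)
    {l : α} (hlX : l ∈ ((((gr N).erase b).erase b').erase f).erase e) (hlon : rk N (insert b (insert b' {e, l})) = 3)
    {W : Finset α} (hW : W ∈ d0DON N b' e f) (hc1 : d0c1 N b e f W) (hc2 : ¬ d0c2 N b b' e f W) (hlW : l ∉ W) :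
    2 ≤ ((biIndepSets N 4).filter (fun B =>
      (((f ∈ B ∧ b' ∉ B) ∧ (e ∈ B ∧ b ∉ B)) ∧
        ¬ (insert b (B.erase f) ∈ biIndepSets N 4 ∧ rk N (insert b (insert b' (B.erase f))) = 4)) ∧
      (l ∉ B ∧ ∀ z ∈ (B.erase e).erase f, rk N (insert f (insert e {l, z})) = 4))).card := by
  set X := ((((gr N).erase b).erase b').erase f).erase e with hXdef
  obtain ⟨hτ3, hB1, hlτ, hlcl, hd, he'⟩ :=
    pencilX_D1_data hn hR h he hf hef heb heb' hfb hfb' he1 hfc heb3 hbg hlX hlon hW hc1 hc2 hlW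
  have hWd := hW
  simp only [d0DON, mem_filter] at hWd
  obtain ⟨hbW, hπX, hπ2, hYeq, hWeq, hπe, hYf, hon⟩ :=
    d0_demand_data h hn hf hef heb hfb hfb' (e := e) W hWd.1 hWd.2.1 hWd.2.2
  set π := (W.erase b).erase e with hπdef
  have hτc : (X \ π).card = 3 := card_X_sdiff_pair hn h he hf hef heb heb' hfb hfb' hπX hπ2
  have hτl2 : ((X \ π).erase l).card = 2 := by rw [card_erase_of_mem hlτ, hτc]
  obtain ⟨u, v, huv, hτeq⟩ := card_eq_two.1 hτl2
  have hu : u ∈ (X \ π).erase l := by rw [hτeq]; exact mem_insert_self _ _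
  have hv : v ∈ (X \ π).erase l := by rw [hτeq]; exact mem_insert_of_mem (mem_singleton_self _)
  obtain ⟨xu, hxu, h4u⟩ := pencilX_cross_exists he hf hX hπ2 hπe hB1 hlX hlτ hlcl he' hu
  obtain ⟨xv, hxv, h4v⟩ := pencilX_cross_exists he hf hX hπ2 hπe hB1 hlX hlτ hlcl he' hv
  have hBu := pencilX_cross_free_mem hn h he hf hef heb heb' hfb hfb' he1 hX heb3 hbg hlX hlon hπX hπ2 hπe hB1
    hlτ hlcl hd he' hxu hu h4u
  have hBv := pencilX_cross_free_mem hn h he hf hef heb heb' hfb hfb' he1 hX heb3 hbg hlX hlon hπX hπ2 hπe hB1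
    hlτ hlcl hd he' hxv hv h4v
  have huX : u ∈ X := (mem_sdiff.1 (mem_of_mem_erase hu)).1
  have huπ : u ∉ π := (mem_sdiff.1 (mem_of_mem_erase hu)).2
  have hne : insert f (insert e ({xu, u} : Finset α)) ≠ insert f (insert e {xv, v}) := by
    intro heq
    have hmem : u ∈ insert f (insert e ({xv, v} : Finset α)) := by
      rw [← heq]
      exact mem_insert_of_mem (mem_insert_of_mem (mem_insert_of_mem (mem_singleton_self _)))
    simp only [mem_insert, mem_singleton] at hmem
    rcases hmem with h' | h' | h' | h'
    · exact (mem_erase.1 (mem_erase.1 huX).2).1 h'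
    · exact (mem_erase.1 huX).1 h'
    · exact huπ (h' ▸ hxv)
    · exact huv h'
  calc 2 = ({insert f (insert e ({xu, u} : Finset α)), insert f (insert e {xv, v})} : Finset (Finset α)).card :=
        (card_pair hne).symm
    _ ≤ _ := by
        apply card_le_card
        intro B hB
        simp only [mem_insert, mem_singleton] at hB
        rcases hB with rfl | rfl
        · exact hBu
        · exact hBv

end StarSharpPencilE

end PercRepro.Cogirth
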